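import Literature.MathematicalPhysics.QuantumFieldTheory.Balaban1983to89.B9Thm39CinvFinalLoc

/-!
# `Balaban1983to89.B9Thm39CinvDefect` — [Balaban1985BackgroundPropagators] (3.95)/(3.96) pp. 411–413 ⇒ THEOREM 3.2 (3.48) FOR `C(U) = (Q′G′²Q′*)⁻¹(U)`
# AT def-Y's BLOCK CARRIER, WITH THE LOCAL-INVERSE LAW OF THE CUBE LETTERS HOLDING UP TO A DISPLAYED DEFECT — (3.95) with a FOURTH sum
# (cell `lit-balaban`, G-B9-LETTERS module M5.2-E ∕ M5.6, file E1-1, seat p21 gen 34; design memo `lit-balaban-p21/M52E-DESIGN-p21.md` v1)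

statement-level skeleton of published theorems with citation tags; proofs where landed; nothing here is a claim about the Yang–Mills mass gap

CITATION HEADER (lean-in-tree rule).  B9 = T. Bałaban, *Propagators for lattice gauge theories in a background field*, Commun. Math. Phys. **99** (1985)
389–434 (journal page = PDF page + 388).  p. 409 l. 2–5 «The operators constructed for this sequence [{Ω_n(□)}], which we denote by G′_□(U), C_□(U) =
(Q′(U)G′²_□(U)Q′*(U))⁻¹, G_□(U), satisfy all the inequalities of Theorems 3.1–3.3 correspondingly»; (3.87) p. 409 «C₀ = Σ_{□∈𝒟} h_□C_□h_□»; p. 411 (3.95)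
«Q′G′²Q′*C₀ = I + Σ_□(1 − □̃)Q′G′²Q′*h_□C_□h_□ + Σ_□ □̃Q′(G′² − G′²_□)Q′*h_□C_□h_□ + Σ_□[□̃Q′G′²_□Q′*, h_□]C_□h_□ = I − R», «By the same estimates as in [4],
especially (2.83)–(2.85), we can see that the operator R is small and (Q′G′²Q′*)⁻¹ = C₀(I − R)⁻¹ = Σ_{n=0}^∞ C₀Rⁿ (3.96)»; p. 412 «the operators may differ
outside □̃₀, and the distance from □̃ to □̃₀ᶜ is at least M … This exponential can be estimated by (2δ₀M)⁻¹»; p. 413 Theorem 3.9 «This theorem implies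
Theorem 3.2»; p. 398 Theorem 3.2 (3.48).  [4] = [Balaban1984PropagatorsII] (2.82) p. 237, (2.83)–(2.85) p. 238, Lemma 2.1 (2.61)/(2.66) p. 234, (2.52) p. 232.
Rows B9.Thm3.9 × B9.Thm3.2 × B9.Eq3.95 × B9.Eq3.96 × B9.Eq3.87 (cells only; no row head changes).

WHY THIS FILE (M5.2-E = the supply of M5.6's per-cube local inverses; located print point of the design memo §1).  The identity (3.95) closes as
displayed iff, for every cover cube □, `h_□(□̃·Q′G′²_□Q′*)C_□h_□ = h_□²` with the UN-subscripted (member's) averaging `Q′` — the EXACT local-inverse law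
`hloc` of FILE 1 `B9Thm39CinvTorusRegular.eq395_cutoffs` (r06's ring identity `B9Thm39Sum.eq395_oneSub`, «in the same way as in (2.82) [4]», where the local
operators are compressions of ONE operator and the law IS exact — print's `C_□` IS that compression inverse with the GLOBAL `Q′`, map owner r06 on CMP 96
p. 237, so in print (3.95) is exact).  The TREE's cube letter of record is r05's `B9CubeLettersBondOpsL0.CCubeY` (lead RULING #5) — the SEQUENCE-averaged full
inverse `(Q′_□G′²_□Q′_□*)⁻¹` on the cube sequence's own blocks `BlkCubeY i q`, whose averaging coincides with the member's on `NearH □ ⊇ supp h_□` only (p. 408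
l. 36–44); for it the law holds up to `h_□□̃Q′G′²_□(Q′* − Q′*_□)C_□h_□`, of the order `e^{−O(δ₀M)}` of print's own (3.97) factors (p. 412), and M5.6's `Cl □` on
the member's blocks `BlkY i` is a truncation of it, for which the exact law fails by the same defect (memo §2; cell GAPS `G-B9-p21-01`).  THIS FILE re-runs FILE 1 §1/§3/§4 and
FILE 9a §3 with the law holding UP TO A DISPLAYED DEFECT `E_□`:  `M_{h_□}(χ̃_□L_□)C_□M_{h_□} = M_{h_□}² + E_□` — (3.95) then reads `L·C₀ = 1 − R`,
`R = −(Σ₁ + Σ₂ + Σ₃ + Σ₄)`, `Σ₄ := Σ_□ E_□`, and the (3.96) glue (FILE 1 §2, unchanged: it takes ANY `R`) runs with four (2.85)-shape majorants.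

WHAT IS PROVED (all `theorem`s, 0 `def`, 0 sorry, 0 new named facts).
* §1 `eq395_sum_defect` ∕ `eq395_oneSub_defect` — (3.95) in any ring with the defect family `E`;  `eq395_cutoffs_defect` — at cut-off letters on any carrier.
* §2 `hasMajorant_four` — four (2.85)-shape majorants add up;  `hasMajorant_localize_left` — an operator with a cut-off `M_h` on the LEFT is localized at
  the output side for free;  ★ `hR₄_of_cubes` — the fourth sum `−Σ₄` has the majorant `N·κ_E·e^{−r·d}` from per-cube majorants `κ_E·e^{−r·d}` of `E_□`
  (overlap `≦ N`; the left `M_{h_□}` of `E_□ = M_{h_□}(χ̃_□L_□C_□M_{h_□} − M_{h_□})` localizes).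
* §3 ★★ `hasMajorant_conj_Cinv_of_cubes_defect` — FILE 9a's `hasMajorant_conj_Cinv_of_cubes'` with `hloc` replaced by the defect law `hdef` and a fourth
  displayed sum majorant `hR₄`: `conj b (s•T) ≺ N·A·c₁(1 − (θ₁+θ₂+θ₃+θ₄)c₁)⁻¹·P(a)·e^{−(1−α′)r·d}`.
* §4 ★★ `hasMajorant_conj_Cinv_final_loc_defect` — FILE 9b §1 (`hasMajorant_conj_Cinv_final_loc`) with the defect: the three sums from FILE 9a's per-cube
  lemmas verbatim, the fourth from §2, `θ₄ = N·κ_E·e^{−a_Xδ₀D_sep}` (the display carries the separation factor so that the located smallness can be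
  discharged «for M sufficiently large» downstream, as for `θ₂`).

HONEST SCOPE / NOT CLAIMED.  The fourth sum is an (R)-DESIGN TERM, NOT IN PRINT (cell GAPS `G-B9-p21-01`): print's `C_□` is [4] (2.79)–(2.82)'s inverse of the compression of
`□̃Q′G′(□̃)²Q′*□̃` to `𝔅 ∩ □̃` with the GLOBAL averaging `Q′` (p. 411 «in the same way as in (2.82) [4]»; map owner r06 first-hand on CMP 96 p. 237), for which (3.95)
is an EXACT identity; the tree's cube letter of record `B9CubeLettersBondOpsL0.CCubeY` (lead RULING #5: the SEQUENCE-averaged full inverse `(Q′_□G′²_□Q′_□*)⁻¹` on the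
cube sequence's own blocks, chosen to avoid inverse-of-compression decay at a general field; its averaging coincides with the member's on `NearH □ ⊇ supp h_□` only)
satisfies the law only up to the defect `h_□□̃Q′G′²_□(Q′* − Q′*_□)C_□h_□`, of size `e^{−O(δ₀M)}` = the order of print's own (3.97) factors (p. 412 l. 31–35); nothing fails
as printed (v1.1 wording, superseding v1.0's).  The defect is bounded by inputs print already has ((3.42) for `G′_□` through the
`Q′`-sandwich, (3.48) for `C_□`, [4] Lemma 2.1, the level gap (2.60)).  The defect majorant `hE` is DISPLAYED here (its discharge
from the cube sequence is the supply files E2 of the memo); so are the three sums' inputs exactly as in FILES 9a/9b (`hC` un-localized, `hD` = GAP G-B9-05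
localized, `hLmaj`/`hLloc`, cut-offs, geometry).  Sup-entry (3.48) only.  Finite 𝕋 member of the k-level V1 family; constants explicit; nothing continuum,
nothing about the mass gap; NOT summit progress.  RELATED, NOT DUPLICATED (searched 2026-08-28: `lean search 'eq395.*defect|Cinv_of_cubes_defect|hR4_of' --decl`
= ∅): FILE 1 `B9Thm39CinvTorusRegular` (exact law; kept for its consumers), FILE 9a/9b, r06 `B9Thm39Sum` (scalar, exact law).
-/

noncomputable section

namespace Literature.MathematicalPhysics.QuantumFieldTheory.Balaban1983to89.B9Thm39CinvDefect

open Node00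
open B6KLevelCensusIndexV1 (KIdx)
open B6RandomWalk (HasMajorant BlockSupp Triangle254 Ineq261 Ineq263 hasMajorant_mono hasMajorant_add)
open B9Thm34Ext (toB6)
open B9GeoNormsKLevelV1 (geo9K)
open B9Eq352DivFormLetters (conj conj_sub conj_neg)
open B9Thm37Sum (mulOp mulOp_apply hasMajorant_localSum)
open B9Thm37CubeCoverCommutators (cutMulY cutMulY_apply)
open B9Thm37GpTorusRegular (conj_one conj_sum conj_smul)
open B9Thm39CinvTorusRegular (conj_add conj_cutMulY sum_cutMulY_sq hasMajorant_conj_C0_of_cubes hasMajorant_conj_Cinv_of_395)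
open B9Thm39CinvSumsYLoc (hR₁_of_cubes' hR₂_of_cubes_loc hR₃_of_cubes')
open B9Ineq368PPrime (hasMajorant_neg)

variable {d ℓ : ℕ} {hd : 1 ≤ d + 1} {hL : Odd (ℓ + 1) ∧ 1 < ℓ + 1} {b₀ b₁ : ℝ}
variable {𝔸 : Type} [NormedRing 𝔸] [NormedAlgebra ℂ 𝔸] [CompleteSpace 𝔸]
variable {ι : Type} [Fintype ι]
variable (i : KIdx d ℓ hd hL b₀ b₁) (b : Module.Basis ι ℝ 𝔸)

/-! ## §1 (3.95) with the local-inverse law holding up to a defect: a ring identity with a fourth sum -/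

section Algebra

variable {S : Type}

/-- **(3.95) WITH A DEFECT, in any ring**: with `L = Q′G′²Q′*`, local letters `L_□` (`Lloc`), characteristic cut-offs `□̃` (`Chi`), the partition `h_□`
(`Hm`, `Σ_□h_□² = 1`), local inverses `C_□` (`Cl`) and the law `h_□(□̃L_□)C_□h_□ = h_□² + E_□`:
`L·Σ_□h_□C_□h_□ = 1 + Σ_□E_□ + Σ_□(1 − □̃)L·h_□C_□h_□ + Σ_□ □̃(L − L_□)·h_□C_□h_□ + Σ_□(□̃L_□h_□ − h_□□̃L_□)C_□h_□` (r06's `eq395_sum` is the case `E = 0`).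
[cite: Balaban1985BackgroundPropagators, (3.95) p.411 + p.409 l.2–5; Balaban1984PropagatorsII, (2.82) p.237] -/
theorem eq395_sum_defect {A : Type*} [Ring A] {κ : Type} [Fintype κ] (L : A) (Hm Chi Cl Lloc E : κ → A)
    (hdef : ∀ k, Hm k * (Chi k * Lloc k) * Cl k * Hm k = Hm k * Hm k + E k) (hpu : ∑ k, Hm k * Hm k = 1) :
    L * (∑ k, Hm k * Cl k * Hm k) =
      1 + ∑ k, E k + ∑ k, (1 - Chi k) * L * (Hm k * Cl k * Hm k) + ∑ k, Chi k * (L - Lloc k) * (Hm k * Cl k * Hm k) +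
        ∑ k, (Chi k * Lloc k * Hm k - Hm k * (Chi k * Lloc k)) * Cl k * Hm k := by
  have hterm : ∀ k, L * (Hm k * Cl k * Hm k) = Hm k * Hm k + E k + ((1 - Chi k) * L * (Hm k * Cl k * Hm k) +
      Chi k * (L - Lloc k) * (Hm k * Cl k * Hm k) + (Chi k * Lloc k * Hm k - Hm k * (Chi k * Lloc k)) * Cl k * Hm k) := by
    intro k
    have h : L * (Hm k * Cl k * Hm k) = Hm k * (Chi k * Lloc k) * Cl k * Hm k +
        ((1 - Chi k) * L * (Hm k * Cl k * Hm k) + Chi k * (L - Lloc k) * (Hm k * Cl k * Hm k) +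
          (Chi k * Lloc k * Hm k - Hm k * (Chi k * Lloc k)) * Cl k * Hm k) := by
      noncomm_ring
    rw [hdef k] at h
    exact h
  rw [Finset.mul_sum, Finset.sum_congr rfl fun k _ => hterm k, Finset.sum_add_distrib, Finset.sum_add_distrib, hpu,
    Finset.sum_add_distrib, Finset.sum_add_distrib]
  abel

/-- **(3.95) with a defect in the form «= I − R»**, `R := −Σ₁ + −Σ₂ + −Σ₃ + −Σ₄` (`Σ₄ = Σ_□E_□`). [cite: Balaban1985BackgroundPropagators, (3.95) p.411] -/
theorem eq395_oneSub_defect {A : Type*} [Ring A] {κ : Type} [Fintype κ] (L : A) (Hm Chi Cl Lloc E : κ → A)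
    (hdef : ∀ k, Hm k * (Chi k * Lloc k) * Cl k * Hm k = Hm k * Hm k + E k) (hpu : ∑ k, Hm k * Hm k = 1) :
    L * (∑ k, Hm k * Cl k * Hm k) =
      1 - (-(∑ k, (1 - Chi k) * L * (Hm k * Cl k * Hm k)) + -(∑ k, Chi k * (L - Lloc k) * (Hm k * Cl k * Hm k)) +
        -(∑ k, (Chi k * Lloc k * Hm k - Hm k * (Chi k * Lloc k)) * Cl k * Hm k) + -(∑ k, E k)) := by
  rw [eq395_sum_defect L Hm Chi Cl Lloc E hdef hpu]
  abel

omit [CompleteSpace 𝔸] in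
/-- **(3.95) WITH A DEFECT AT CUT-OFF LETTERS** on any carrier `S`: `L·Σ_□M_{h_□}C_□M_{h_□} = 1 − R`, `R = −Σ₁ + −Σ₂ + −Σ₃ + −Σ₄`, given
`M_{h_□}(χ̃_□L_□)C_□M_{h_□} = M_{h_□}M_{h_□} + E_□` and `Σ_□h_□² = 1`. [cite: Balaban1985BackgroundPropagators, (3.95) p.411 + (3.87) p.409] -/
theorem eq395_cutoffs_defect {κ : Type} [Fintype κ] (L : Module.End ℝ (S → 𝔸)) (h : κ → S → ℝ) (hsq : ∀ s, ∑ k, h k s ^ 2 = 1)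
    (Chi Cl Lloc E : κ → Module.End ℝ (S → 𝔸))
    (hdef : ∀ k, (cutMulY (𝔸 := 𝔸) (h k)).restrictScalars ℝ * (Chi k * Lloc k) * Cl k * (cutMulY (𝔸 := 𝔸) (h k)).restrictScalars ℝ
      = (cutMulY (𝔸 := 𝔸) (h k)).restrictScalars ℝ * (cutMulY (𝔸 := 𝔸) (h k)).restrictScalars ℝ + E k) :
    L * (∑ k, (cutMulY (𝔸 := 𝔸) (h k)).restrictScalars ℝ * Cl k * (cutMulY (𝔸 := 𝔸) (h k)).restrictScalars ℝ) =
      1 - (-(∑ k, (1 - Chi k) * L * ((cutMulY (𝔸 := 𝔸) (h k)).restrictScalars ℝ * Cl k * (cutMulY (𝔸 := 𝔸) (h k)).restrictScalars ℝ)) +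
        -(∑ k, Chi k * (L - Lloc k) * ((cutMulY (𝔸 := 𝔸) (h k)).restrictScalars ℝ * Cl k * (cutMulY (𝔸 := 𝔸) (h k)).restrictScalars ℝ)) +
        -(∑ k, (Chi k * Lloc k * (cutMulY (𝔸 := 𝔸) (h k)).restrictScalars ℝ - (cutMulY (𝔸 := 𝔸) (h k)).restrictScalars ℝ * (Chi k * Lloc k)) * Cl k *
          (cutMulY (𝔸 := 𝔸) (h k)).restrictScalars ℝ) + -(∑ k, E k)) :=
  eq395_oneSub_defect L (fun k => (cutMulY (𝔸 := 𝔸) (h k)).restrictScalars ℝ) Chi Cl Lloc E hdef (sum_cutMulY_sq h hsq)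

omit [CompleteSpace 𝔸] in
/-- **the defect is `E_□ = M_{h_□}·((χ̃_□L_□)C_□M_{h_□} − M_{h_□})`** — it carries the cut-off `M_{h_□}` on the left (and on the right).
[cite: Balaban1985BackgroundPropagators, (3.95) p.411, bookkeeping] -/
theorem defect_eq_cut_mul {h : S → ℝ} {Chi Cl Lloc E : Module.End ℝ (S → 𝔸)}
    (hdef : (cutMulY (𝔸 := 𝔸) h).restrictScalars ℝ * (Chi * Lloc) * Cl * (cutMulY (𝔸 := 𝔸) h).restrictScalars ℝ
      = (cutMulY (𝔸 := 𝔸) h).restrictScalars ℝ * (cutMulY (𝔸 := 𝔸) h).restrictScalars ℝ + E) :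
    E = (cutMulY (𝔸 := 𝔸) h).restrictScalars ℝ * ((Chi * Lloc) * Cl * (cutMulY (𝔸 := 𝔸) h).restrictScalars ℝ - (cutMulY (𝔸 := 𝔸) h).restrictScalars ℝ) := by
  have h1 : E = (cutMulY (𝔸 := 𝔸) h).restrictScalars ℝ * (Chi * Lloc) * Cl * (cutMulY (𝔸 := 𝔸) h).restrictScalars ℝ -
      (cutMulY (𝔸 := 𝔸) h).restrictScalars ℝ * (cutMulY (𝔸 := 𝔸) h).restrictScalars ℝ := by
    rw [hdef]; abel
  rw [h1, mul_sub]
  simp only [mul_assoc]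

end Algebra

/-! ## §2 Four sums; the fourth sum from per-cube defect majorants -/

section Sums

variable [DecidableEq ι] [Fintype (geo9K i).Site] [DecidableEq (geo9K i).Site] {Rr : ℝ} {Hp : Prop}
variable (ιB : BlkY i → IBondY i)

omit [CompleteSpace 𝔸] [DecidableEq ι] [DecidableEq (geo9K i).Site] in
/-- **four (2.85)-shape majorants add up**: `conj b (R₁ + R₂ + R₃ + R₄) ≺ (θ₁+θ₂+θ₃+θ₄)·e^{−r·d}`.
[cite: Balaban1985BackgroundPropagators, (3.95) p.411; Balaban1984PropagatorsII, (2.85) p.238 («A summation preserves it also» p.232)] -/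
theorem hasMajorant_four {r θ₁ θ₂ θ₃ θ₄ : ℝ} {R₁ R₂ R₃ R₄ : Module.End ℝ (BlkY i → 𝔸)}
    (h₁ : HasMajorant (g := toB6 (geo9K i) Rr Hp) (fun p : BlkY i × ι => ιB p.1) (conj b R₁) (fun a a' => θ₁ * Real.exp (-(r * (geo9K i).dist a a'))))
    (h₂ : HasMajorant (g := toB6 (geo9K i) Rr Hp) (fun p : BlkY i × ι => ιB p.1) (conj b R₂) (fun a a' => θ₂ * Real.exp (-(r * (geo9K i).dist a a'))))
    (h₃ : HasMajorant (g := toB6 (geo9K i) Rr Hp) (fun p : BlkY i × ι => ιB p.1) (conj b R₃) (fun a a' => θ₃ * Real.exp (-(r * (geo9K i).dist a a'))))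
    (h₄ : HasMajorant (g := toB6 (geo9K i) Rr Hp) (fun p : BlkY i × ι => ιB p.1) (conj b R₄) (fun a a' => θ₄ * Real.exp (-(r * (geo9K i).dist a a')))) :
    HasMajorant (g := toB6 (geo9K i) Rr Hp) (fun p : BlkY i × ι => ιB p.1) (conj b (R₁ + R₂ + R₃ + R₄))
      (fun a a' => (θ₁ + θ₂ + θ₃ + θ₄) * Real.exp (-(r * (geo9K i).dist a a'))) := by
  rw [conj_add, conj_add, conj_add]
  refine hasMajorant_mono (g := toB6 (geo9K i) Rr Hp) _ (hasMajorant_add _ (hasMajorant_add _ (hasMajorant_add _ h₁ h₂) h₃) h₄)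
    fun a a' => le_of_eq ?_
  ring

omit [CompleteSpace 𝔸] [DecidableEq ι] in
/-- **an operator with a cut-off on the LEFT is localized at the output side for free**: if `conj b (M_h·T′) ≺ K` and `supp h ⊂ S` through `ιB`, then
`conj b (M_h·T′) ≺ 𝟙[a ∈ S]·K(a, a′)` (written as a product, the shape r06's `hasMajorant_localSum` consumes) — outside `supp h` the output vanishes. [cite: Balaban1985BackgroundPropagators, (3.87) p.409 + p.411 («restrict a kernel of the term»), bookkeeping] -/
theorem hasMajorant_localize_left (h : BlkY i → ℝ) (T' : Module.End ℝ (BlkY i → 𝔸)) (Sk : Finset (geo9K i).Site)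
    {K : (geo9K i).Site → (geo9K i).Site → ℝ} (hS : ∀ t, h t ≠ 0 → ιB t ∈ Sk)
    (hT : HasMajorant (g := toB6 (geo9K i) Rr Hp) (fun p : BlkY i × ι => ιB p.1) (conj b ((cutMulY (𝔸 := 𝔸) h).restrictScalars ℝ * T')) K) :
    HasMajorant (g := toB6 (geo9K i) Rr Hp) (fun p : BlkY i × ι => ιB p.1) (conj b ((cutMulY (𝔸 := 𝔸) h).restrictScalars ℝ * T'))
      (fun a a' => (if a ∈ Sk then (1 : ℝ) else 0) * K a a') := by
  intro y' μ B hμ p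
  show |conj b ((cutMulY (𝔸 := 𝔸) h).restrictScalars ℝ * T') μ p| ≤ (if ιB p.1 ∈ Sk then (1 : ℝ) else 0) * K (ιB p.1) y' * B
  by_cases hp : ιB p.1 ∈ Sk
  · rw [if_pos hp, one_mul]
    exact hT y' μ B hμ p
  · have h0 : h p.1 = 0 := by
      by_contra hne
      exact hp (hS p.1 hne)
    have h2 : conj b ((cutMulY (𝔸 := 𝔸) h).restrictScalars ℝ * T') μ p = 0 := by
      rw [B9Eq352DivFormLetters.conj_mul, conj_cutMulY, Module.End.mul_apply, mulOp_apply, h0, zero_mul]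
    rw [if_neg hp, h2, abs_zero, zero_mul, zero_mul]

omit [CompleteSpace 𝔸] [DecidableEq ι] in
/-- ★ **THE FOURTH SUM OF (3.95) FROM PER-CUBE DEFECT MAJORANTS** ((2.83) ⇒ (2.85) counting, [4] p. 238 «following from all the partial estimates of the type
(2.83)»): if every defect `E_□` (law `M_{h_□}(χ̃_□L_□)C_□M_{h_□} = M_{h_□}² + E_□`, so `E_□ = M_{h_□}·(…)`) has the majorant `κ_E·e^{−r·d(a,a′)}`, `supp h_□ ⊂ S_□`
through `ιB` and the overlap is `≦ N`, then `conj b (−Σ_□E_□) ≺ N·κ_E·e^{−r·d(a,a′)}`.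
[cite: Balaban1985BackgroundPropagators, (3.95) p.411 + p.409 l.2–5; Balaban1984PropagatorsII, (2.83)–(2.85) p.238] -/
theorem hR₄_of_cubes {r κE N : ℝ} {κ : Type} [Fintype κ] (S : κ → Finset (geo9K i).Site) (h : κ → BlkY i → ℝ)
    (Chi Cl Lloc E : κ → Module.End ℝ (BlkY i → 𝔸)) (hκE : 0 ≤ κE)
    (hS : ∀ k t, h k t ≠ 0 → ιB t ∈ S k) (hcnt : ∀ a : (geo9K i).Site, (∑ k, if a ∈ S k then (1 : ℝ) else 0) ≤ N)
    (hdef : ∀ k, (cutMulY (𝔸 := 𝔸) (h k)).restrictScalars ℝ * (Chi k * Lloc k) * Cl k * (cutMulY (𝔸 := 𝔸) (h k)).restrictScalars ℝ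
      = (cutMulY (𝔸 := 𝔸) (h k)).restrictScalars ℝ * (cutMulY (𝔸 := 𝔸) (h k)).restrictScalars ℝ + E k)
    (hE : ∀ k, HasMajorant (g := toB6 (geo9K i) Rr Hp) (fun p : BlkY i × ι => ιB p.1) (conj b (E k))
      (fun a a' => κE * Real.exp (-(r * (geo9K i).dist a a')))) :
    HasMajorant (g := toB6 (geo9K i) Rr Hp) (fun p : BlkY i × ι => ιB p.1) (conj b (-(∑ k, E k)))
      (fun a a' => N * (κE * Real.exp (-(r * (geo9K i).dist a a')))) := by
  rw [conj_neg]
  refine hasMajorant_neg (g := geo9K i) (R := Rr) (H := Hp) _ ?_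
  rw [conj_sum]
  refine hasMajorant_localSum (G := toB6 (geo9K i) Rr Hp) (fun p : BlkY i × ι => ιB p.1) _
    (fun k (a : (geo9K i).Site) => if a ∈ S k then (1 : ℝ) else 0) _ N (fun a a' => mul_nonneg hκE (Real.exp_nonneg _)) (fun k => ?_) hcnt
  have hEk := defect_eq_cut_mul (hdef k)
  have hloc := hasMajorant_localize_left i b (Rr := Rr) (Hp := Hp) ιB (h k)
    ((Chi k * Lloc k) * Cl k * (cutMulY (𝔸 := 𝔸) (h k)).restrictScalars ℝ - (cutMulY (𝔸 := 𝔸) (h k)).restrictScalars ℝ) (S k)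
    (fun t ht => hS k t ht) (by rw [← hEk]; exact hE k)
  rw [← hEk] at hloc
  exact hloc

end Sums

/-! ## §3 ★★ The glue with four sums: FILE 9a's `hasMajorant_conj_Cinv_of_cubes'` with the defect law -/

section Glue

variable [DecidableEq ι] [Fintype (geo9K i).Site] [DecidableEq (geo9K i).Site] {Rr : ℝ} {Hp : Prop}
variable (ιB : BlkY i → IBondY i)

omit [CompleteSpace 𝔸] in
/-- ★★ **THEOREM 3.9 ⇒ THEOREM 3.2's (3.48) BLOCK FOR `C(U)`, FROM THE CUBE DATA, LOCAL-INVERSE LAW UP TO A DEFECT**: letters `L`, `T` with `T·L = 1`; block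
cut-offs `h_□` (`|h_□| ≦ 1`, `supp h_□ ⊂ S_□` through `ιB`, `Σh_□² = 1`, overlap `≦ N`); local letters `Chi_□`, `L_□`, `C_□`, defects `E_□` with
`M_{h_□}(Chi_□L_□)C_□M_{h_□} = M_{h_□}² + E_□`; per-cube (3.48) blocks `A·P(a)e^{−r·d}` of `conj b (s•C_□)` (all `a, a′`); the FOUR sums of (3.95) with
(2.85)-shape majorants `θ_m e^{−r·d}`; [4] Lemma 2.1 at `(r, α′)`, `(θ₁+θ₂+θ₃+θ₄)c₁ < 1` ⟹ `conj b (s•T) ≺ N·A·c₁(1 − (θ₁+θ₂+θ₃+θ₄)c₁)⁻¹·P(a)·e^{−(1−α′)r·d}`.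
[cite: Balaban1985BackgroundPropagators, Thm 3.9 p.413 + (3.95)–(3.96) p.411 + (3.87) p.409 + Thm 3.2 (3.48) p.398; Balaban1984PropagatorsII, (2.66) p.234] -/
theorem hasMajorant_conj_Cinv_of_cubes_defect (d' : ℕ) {r α' θ₁ θ₂ θ₃ θ₄ A N : ℝ} (P : (geo9K i).Site → ℝ) (s : ℝ)
    {κ : Type} [Fintype κ] (S : κ → Finset (geo9K i).Site) (h : κ → BlkY i → ℝ)
    {L T : Module.End ℝ (BlkY i → 𝔸)} (Chi Cl Lloc E : κ → Module.End ℝ (BlkY i → 𝔸))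
    (hA : 0 ≤ A) (hP : ∀ a, 0 ≤ P a) (hN : 0 ≤ N) (hθ₁ : 0 ≤ θ₁) (hθ₂ : 0 ≤ θ₂) (hθ₃ : 0 ≤ θ₃) (hθ₄ : 0 ≤ θ₄) (hαr : 0 ≤ (1 - α') * r)
    (htri : Triangle254 (toB6 (geo9K i) Rr Hp)) (hrefl : ∀ y : (geo9K i).Site, (geo9K i).dist y y = 0)
    (hdnn : ∀ y y' : (geo9K i).Site, 0 ≤ (geo9K i).dist y y')
    (h261 : Ineq261 d' (toB6 (geo9K i) Rr Hp) r α') (h263 : Ineq263 d' (toB6 (geo9K i) Rr Hp) r α')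
    (hsmall : (θ₁ + θ₂ + θ₃ + θ₄) * B6.c1 d' r α' < 1)
    (hinv : T * L = 1) (hsq : ∀ t, ∑ k, h k t ^ 2 = 1) (hh : ∀ k t, |h k t| ≤ 1) (hS : ∀ k t, h k t ≠ 0 → ιB t ∈ S k)
    (hcnt : ∀ a : (geo9K i).Site, (∑ k, if a ∈ S k then (1 : ℝ) else 0) ≤ N)
    (hdef : ∀ k, (cutMulY (𝔸 := 𝔸) (h k)).restrictScalars ℝ * (Chi k * Lloc k) * Cl k * (cutMulY (𝔸 := 𝔸) (h k)).restrictScalars ℝ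
      = (cutMulY (𝔸 := 𝔸) (h k)).restrictScalars ℝ * (cutMulY (𝔸 := 𝔸) (h k)).restrictScalars ℝ + E k)
    (hC : ∀ k, HasMajorant (g := toB6 (geo9K i) Rr Hp) (fun p : BlkY i × ι => ιB p.1) (conj b (s • Cl k))
      (fun a a' => A * P a * Real.exp (-(r * (geo9K i).dist a a'))))
    (hR₁ : HasMajorant (g := toB6 (geo9K i) Rr Hp) (fun p : BlkY i × ι => ιB p.1)
      (conj b (-(∑ k, (1 - Chi k) * L * ((cutMulY (𝔸 := 𝔸) (h k)).restrictScalars ℝ * Cl k * (cutMulY (𝔸 := 𝔸) (h k)).restrictScalars ℝ))))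
      (fun a a' => θ₁ * Real.exp (-(r * (geo9K i).dist a a'))))
    (hR₂ : HasMajorant (g := toB6 (geo9K i) Rr Hp) (fun p : BlkY i × ι => ιB p.1)
      (conj b (-(∑ k, Chi k * (L - Lloc k) * ((cutMulY (𝔸 := 𝔸) (h k)).restrictScalars ℝ * Cl k * (cutMulY (𝔸 := 𝔸) (h k)).restrictScalars ℝ))))
      (fun a a' => θ₂ * Real.exp (-(r * (geo9K i).dist a a'))))
    (hR₃ : HasMajorant (g := toB6 (geo9K i) Rr Hp) (fun p : BlkY i × ι => ιB p.1)
      (conj b (-(∑ k, (Chi k * Lloc k * (cutMulY (𝔸 := 𝔸) (h k)).restrictScalars ℝ -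
        (cutMulY (𝔸 := 𝔸) (h k)).restrictScalars ℝ * (Chi k * Lloc k)) * Cl k * (cutMulY (𝔸 := 𝔸) (h k)).restrictScalars ℝ)))
      (fun a a' => θ₃ * Real.exp (-(r * (geo9K i).dist a a'))))
    (hR₄ : HasMajorant (g := toB6 (geo9K i) Rr Hp) (fun p : BlkY i × ι => ιB p.1) (conj b (-(∑ k, E k)))
      (fun a a' => θ₄ * Real.exp (-(r * (geo9K i).dist a a')))) :
    HasMajorant (g := toB6 (geo9K i) Rr Hp) (fun p : BlkY i × ι => ιB p.1) (conj b (s • T))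
      (fun a a' => N * A * B6.c1 d' r α' * (1 - (θ₁ + θ₂ + θ₃ + θ₄) * B6.c1 d' r α')⁻¹ * P a *
        Real.exp (-((1 - α') * r * (geo9K i).dist a a'))) := by
  have h395 := eq395_cutoffs_defect L h hsq Chi Cl Lloc E hdef
  have hC0 := hasMajorant_conj_C0_of_cubes i b (Rr := Rr) (Hp := Hp) ιB S h Cl s
    (K := fun a a' => A * P a * Real.exp (-(r * (geo9K i).dist a a')))
    (fun a a' => mul_nonneg (mul_nonneg hA (hP a)) (Real.exp_nonneg _)) hh hS hC hcnt
  have hmaj := hasMajorant_conj_Cinv_of_395 i b ιB d' P s (A := N * A) (θ := θ₁ + θ₂ + θ₃ + θ₄) (mul_nonneg hN hA) hP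
    (add_nonneg (add_nonneg (add_nonneg hθ₁ hθ₂) hθ₃) hθ₄) hαr htri hrefl hdnn h261 h263 hsmall hinv h395
    (hasMajorant_mono (g := toB6 (geo9K i) Rr Hp) _ hC0 fun a a' => le_of_eq (by ring)) (hasMajorant_four i b ιB hR₁ hR₂ hR₃ hR₄)
  exact hasMajorant_mono (g := toB6 (geo9K i) Rr Hp) _ hmaj fun a a' => le_of_eq (by ring)

end Glue

/-! ## §4 ★★ At the printed shapes of the per-cube inputs: FILE 9b §1 with the defect -/

section Final

variable [DecidableEq ι] [Fintype (geo9K i).Site] [DecidableEq (geo9K i).Site] {Rr : ℝ} {Hp : Prop}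
variable (ιB : BlkY i → IBondY i)

omit [CompleteSpace 𝔸] in
/-- ★★ **THEOREM 3.9 ⇒ THEOREM 3.2's (3.48) BLOCK FOR `C(U) = (Q′G′²Q′*)⁻¹(U)` AT def-Y's CARRIERS, FROM PER-CUBE DISPLAYED DATA IN THE PRINTED SHAPES, LOCAL-INVERSE
LAW UP TO A DEFECT** (FILE 9b `hasMajorant_conj_Cinv_final_loc` with `hloc` replaced by `hdef` + `hE`): `conj b (s•T) ≺ N B₀ c₁(ρδ₀,α′)(1 − (θ₁+θ₂+θ₃+θ₄)c₁(ρδ₀,α′))⁻¹·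
P(a)·e^{−(1−α′)ρδ₀d(a,a′)}` with `θ₁ = NκB₀Cc₁(δ₀,b−ρ)e^{−a_sepδ₀D_sep}`, `θ₂ = Nκ_De^{−2δ₀D_sep}B₀Cc₁(δ₀,b−ρ)`, `θ₃ = N(ℓ₀ + ℓ₁(α_cδ₀)⁻¹)κB₀Cc₁(δ₀,b−ρ)`,
`θ₄ = Nκ_Ee^{−a_Xδ₀D_sep}` — the defect majorant displayed as `hE : conj b (E_□) ≺ κ_E·e^{−a_Xδ₀D_sep}·e^{−a_Eδ₀d}` with `ρ ≦ a_E` (the (R)-design fourth sum, not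
in print; see the module docstring and GAPS `G-B9-p21-01`). [cite: Balaban1985BackgroundPropagators, Thm 3.9 p.413 + (3.95)–(3.97) pp.411–412 + (3.87) p.409 + p.409 l.2–5 + Thm 3.2 (3.48) p.398; Balaban1984PropagatorsII, (2.66) p.234 + (2.83)–(2.85) pp.237–238] -/
theorem hasMajorant_conj_Cinv_final_loc_defect (d' : ℕ)
    {δ₀ aL aD aE aX αc αst asep ρ bb κ κD κE Dsep ℓ₀ ℓ₁ B₀ C N s s' α' θ₁ θ₂ θ₃ θ₄ : ℝ} (P : (geo9K i).Site → ℝ)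
    {κι : Type} [Fintype κι] (Sχ S : κι → Finset (geo9K i).Site) (χ h : κι → BlkY i → ℝ)
    {L T : Module.End ℝ (BlkY i → 𝔸)} (Lloc Cl E : κι → Module.End ℝ (BlkY i → 𝔸))
    -- constants and exponent bookkeeping
    (hs : s' * s = 1) (hκ : 0 ≤ κ) (hκD : 0 ≤ κD) (hκE : 0 ≤ κE) (hℓ₀ : 0 ≤ ℓ₀) (hℓ₁ : 0 ≤ ℓ₁) (hB₀ : 0 ≤ B₀) (hC0 : 0 ≤ C) (hN : 0 ≤ N)
    (hP : ∀ a, 0 < P a) (hδ₀ : 0 ≤ δ₀) (hasep : 0 ≤ asep) (hρ : 0 ≤ ρ) (hρb : ρ ≤ bb) (hρE : ρ ≤ aE) (hαc : 0 < αc * δ₀) (hα'1 : α' ≤ 1)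
    (hsplit₁ : αst + asep + ρ ≤ aL) (hsplit₂ : αst + ρ ≤ aD) (hsplit₃ : αst + αc + ρ ≤ aL)
    (hθ₁ : θ₁ = N * (κ * B₀ * C * B6.c1 d' δ₀ (bb - ρ) * Real.exp (-(asep * δ₀ * Dsep))))
    (hθ₂ : θ₂ = N * (κD * Real.exp (-(2 * δ₀ * Dsep)) * B₀ * C * B6.c1 d' δ₀ (bb - ρ)))
    (hθ₃ : θ₃ = N * ((ℓ₀ + ℓ₁ * (αc * δ₀)⁻¹) * κ * B₀ * C * B6.c1 d' δ₀ (bb - ρ)))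
    (hθ₄ : θ₄ = N * (κE * Real.exp (-(aX * δ₀ * Dsep))))
    -- the geometry of the member
    (htri : Triangle254 (toB6 (geo9K i) Rr Hp)) (hrefl : ∀ y : (geo9K i).Site, (geo9K i).dist y y = 0)
    (hsymm : ∀ a a' : (geo9K i).Site, (geo9K i).dist a a' = (geo9K i).dist a' a) (hdnn : ∀ a a' : (geo9K i).Site, 0 ≤ (geo9K i).dist a a')
    (hST : B9Ineq347.ScaleTransfer (geo9K i) δ₀ αst C P) (h261b : Ineq261 d' (toB6 (geo9K i) Rr Hp) δ₀ (bb - ρ))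
    (h261 : Ineq261 d' (toB6 (geo9K i) Rr Hp) (ρ * δ₀) α') (h263 : Ineq263 d' (toB6 (geo9K i) Rr Hp) (ρ * δ₀) α')
    (hsmall : (θ₁ + θ₂ + θ₃ + θ₄) * B6.c1 d' (ρ * δ₀) α' < 1)
    -- the letters: inverse, partition, cut-offs, separation, slow variation, local-inverse law up to the defect
    (hinv : T * L = 1) (hsq : ∀ t, ∑ k, h k t ^ 2 = 1) (hh : ∀ k t, |h k t| ≤ 1) (hS : ∀ k t, h k t ≠ 0 → ιB t ∈ S k)
    (hcnt : ∀ a : (geo9K i).Site, (∑ k, if a ∈ S k then (1 : ℝ) else 0) ≤ N)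
    (hχ01 : ∀ k t, 0 ≤ χ k t ∧ χ k t ≤ 1) (hχS : ∀ k t, ιB t ∈ Sχ k → χ k t = 1) (hχsupp : ∀ k t, χ k t ≠ 0 → ιB t ∈ Sχ k)
    (hsep : ∀ k a, a ∉ Sχ k → ∀ a'' ∈ S k, Dsep ≤ (geo9K i).dist a a'')
    (hLip : ∀ k (t t' : BlkY i), |h k t' - h k t| ≤ ℓ₀ + ℓ₁ * (geo9K i).dist (ιB t) (ιB t'))
    (hdef : ∀ k, (cutMulY (𝔸 := 𝔸) (h k)).restrictScalars ℝ * ((cutMulY (𝔸 := 𝔸) (χ k)).restrictScalars ℝ * Lloc k) * Cl k *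
      (cutMulY (𝔸 := 𝔸) (h k)).restrictScalars ℝ = (cutMulY (𝔸 := 𝔸) (h k)).restrictScalars ℝ * (cutMulY (𝔸 := 𝔸) (h k)).restrictScalars ℝ + E k)
    -- the per-cube analytic blocks (printed shapes) and the defect majorant
    (hC : ∀ k, HasMajorant (g := toB6 (geo9K i) Rr Hp) (fun p : BlkY i × ι => ιB p.1) (conj b (s • Cl k))
      (fun a a' => B₀ * P a * Real.exp (-(bb * δ₀ * (geo9K i).dist a a'))))
    (hLmaj : HasMajorant (g := toB6 (geo9K i) Rr Hp) (fun p : BlkY i × ι => ιB p.1) (conj b (s' • L))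
      (fun a a'' => κ * (P a)⁻¹ * Real.exp (-(aL * δ₀ * (geo9K i).dist a a''))))
    (hLloc : ∀ k, HasMajorant (g := toB6 (geo9K i) Rr Hp) (fun p : BlkY i × ι => ιB p.1) (conj b (s' • Lloc k))
      (fun a a'' => κ * (P a)⁻¹ * Real.exp (-(aL * δ₀ * (geo9K i).dist a a''))))
    (hD : ∀ k, HasMajorant (g := toB6 (geo9K i) Rr Hp) (fun p : BlkY i × ι => ιB p.1)
      (conj b (s' • ((cutMulY (𝔸 := 𝔸) (fun t : BlkY i => if ιB t ∈ Sχ k then (1 : ℝ) else 0)).restrictScalars ℝ * (L - Lloc k) *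
        (cutMulY (𝔸 := 𝔸) (fun t : BlkY i => if ιB t ∈ S k then (1 : ℝ) else 0)).restrictScalars ℝ)))
      (fun a a'' => κD * Real.exp (-(2 * δ₀ * Dsep)) * (P a)⁻¹ * Real.exp (-(aD * δ₀ * (geo9K i).dist a a''))))
    (hE : ∀ k, HasMajorant (g := toB6 (geo9K i) Rr Hp) (fun p : BlkY i × ι => ιB p.1) (conj b (E k))
      (fun a a' => κE * Real.exp (-(aX * δ₀ * Dsep)) * Real.exp (-(aE * δ₀ * (geo9K i).dist a a')))) :
    HasMajorant (g := toB6 (geo9K i) Rr Hp) (fun p : BlkY i × ι => ιB p.1) (conj b (s • T))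
      (fun a a' => N * B₀ * B6.c1 d' (ρ * δ₀) α' * (1 - (θ₁ + θ₂ + θ₃ + θ₄) * B6.c1 d' (ρ * δ₀) α')⁻¹ * P a *
        Real.exp (-((1 - α') * (ρ * δ₀) * (geo9K i).dist a a'))) := by
  have hc1 : 0 ≤ B6.c1 d' δ₀ (bb - ρ) := B6RandomWalk.c1_nonneg d' δ₀ _
  have hθ₁0 : 0 ≤ θ₁ := by
    rw [hθ₁]; exact mul_nonneg hN (mul_nonneg (mul_nonneg (mul_nonneg (mul_nonneg hκ hB₀) hC0) hc1) (Real.exp_nonneg _))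
  have hθ₂0 : 0 ≤ θ₂ := by
    rw [hθ₂]; exact mul_nonneg hN (mul_nonneg (mul_nonneg (mul_nonneg (mul_nonneg hκD (Real.exp_nonneg _)) hB₀) hC0) hc1)
  have hθ₃0 : 0 ≤ θ₃ := by
    rw [hθ₃]
    exact mul_nonneg hN (mul_nonneg (mul_nonneg (mul_nonneg (mul_nonneg
      (add_nonneg hℓ₀ (mul_nonneg hℓ₁ (inv_nonneg.mpr hαc.le))) hκ) hB₀) hC0) hc1)
  have hθ₄0 : 0 ≤ θ₄ := by
    rw [hθ₄]; exact mul_nonneg hN (mul_nonneg hκE (Real.exp_nonneg _))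
  have hαr : 0 ≤ (1 - α') * (ρ * δ₀) := mul_nonneg (sub_nonneg.mpr hα'1) (mul_nonneg hρ hδ₀)
  have hχ1 : ∀ k t, |χ k t| ≤ 1 := fun k t => by
    obtain ⟨h0, h1⟩ := hχ01 k t
    rw [abs_le]; constructor <;> linarith
  -- the per-cube (3.48) blocks at the weaker rate `ρδ₀` (e^{−bδ₀d} ≤ e^{−ρδ₀d})
  have hC' : ∀ k, HasMajorant (g := toB6 (geo9K i) Rr Hp) (fun p : BlkY i × ι => ιB p.1) (conj b (s • Cl k))
      (fun a a' => B₀ * P a * Real.exp (-(ρ * δ₀ * (geo9K i).dist a a'))) := fun k =>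
    hasMajorant_mono (g := toB6 (geo9K i) Rr Hp) _ (hC k) fun a a' => by
      refine mul_le_mul_of_nonneg_left (Real.exp_le_exp.mpr ?_) (mul_nonneg hB₀ (hP a).le)
      have h1 := mul_le_mul_of_nonneg_right hρb (mul_nonneg hδ₀ (hdnn a a'))
      nlinarith [h1]
  -- the defect majorants at the weaker rate `ρδ₀`
  have hE' : ∀ k, HasMajorant (g := toB6 (geo9K i) Rr Hp) (fun p : BlkY i × ι => ιB p.1) (conj b (E k))
      (fun a a' => κE * Real.exp (-(aX * δ₀ * Dsep)) * Real.exp (-(ρ * δ₀ * (geo9K i).dist a a'))) := fun k =>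
    hasMajorant_mono (g := toB6 (geo9K i) Rr Hp) _ (hE k) fun a a' => by
      refine mul_le_mul_of_nonneg_left (Real.exp_le_exp.mpr ?_) (mul_nonneg hκE (Real.exp_nonneg _))
      have h1 := mul_le_mul_of_nonneg_right hρE (mul_nonneg hδ₀ (hdnn a a'))
      nlinarith [h1]
  -- the three sums (FILE 9a) and the fourth (§2)
  have h1 := hR₁_of_cubes' i b ιB (Rr := Rr) (Hp := Hp) d' P Sχ S χ h Cl hs hκ hB₀ hC0 hP hδ₀ hasep hρ hsplit₁ htri hsymm hdnn hST h261b hχ01 hχS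
    hh hS hsep hcnt hLmaj hC
  have h2 := hR₂_of_cubes_loc i b ιB (Rr := Rr) (Hp := Hp) d' P Sχ S χ h Lloc Cl hs hκD hB₀ hC0 hP hδ₀ hρ hsplit₂ htri hsymm hdnn hST h261b hχ1 hχsupp
    hh hS hcnt hD hC
  have h3 := hR₃_of_cubes' i b ιB (Rr := Rr) (Hp := Hp) d' P S χ h Lloc Cl hs hκ hℓ₀ hℓ₁ hB₀ hC0 hP hδ₀ hαc hρ hsplit₃ htri hsymm hdnn hST h261b hχ1
    hh hS hLip hcnt hLloc hC
  have h4 := hR₄_of_cubes i b ιB (Rr := Rr) (Hp := Hp) S h (fun k => (cutMulY (𝔸 := 𝔸) (χ k)).restrictScalars ℝ) Cl Lloc E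
    (mul_nonneg hκE (Real.exp_nonneg _)) hS hcnt hdef hE'
  rw [← hθ₁] at h1
  rw [← hθ₂] at h2
  rw [← hθ₃] at h3
  have h4' : HasMajorant (g := toB6 (geo9K i) Rr Hp) (fun p : BlkY i × ι => ιB p.1) (conj b (-(∑ k, E k)))
      (fun a a' => θ₄ * Real.exp (-(ρ * δ₀ * (geo9K i).dist a a'))) :=
    hasMajorant_mono (g := toB6 (geo9K i) Rr Hp) _ h4 fun a a' => le_of_eq (by rw [hθ₄]; ring)
  -- §3's glue at the rate `r := ρδ₀`
  exact hasMajorant_conj_Cinv_of_cubes_defect i b ιB d' P s S h (fun k => (cutMulY (𝔸 := 𝔸) (χ k)).restrictScalars ℝ) Cl Lloc E hB₀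
    (fun a => (hP a).le) hN hθ₁0 hθ₂0 hθ₃0 hθ₄0 hαr htri hrefl hdnn h261 h263 hsmall hinv hsq hh hS hcnt hdef hC' h1 h2 h3 h4'

end Final

end Literature.MathematicalPhysics.QuantumFieldTheory.Balaban1983to89.B9Thm39CinvDefect

end
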